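import Mathlib.Algebra.Homology.DerivedCategory.ExactFunctor
import Mathlib.CategoryTheory.Adjunction.Limits
import HarnessLib

/-!
# The derived functor of an exact equivalence of abelian categories is an equivalence

Topic `Algebra/Homology`; namespace `Literature.Algebra.Homology`. Pure homological algebra over Mathlib's
`DerivedCategory`; everything is PROVED, no named fact, no new definition, no instance.

SETTING. `T : C₁ ⥤ C₂` an additive functor between abelian categories (with derived categories) which is an
EQUIVALENCE of categories (`T.IsEquivalence`), hence exact, so that Mathlib's derived functor
`D(T) = T.mapDerivedCategory : D(C₁) ⥤ D(C₂)` (with `FacT : Q ⋙ D(T) ≅ T• ⋙ Q`, `T• = T.mapHomologicalComplex _`)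
exists. THEN:

* `isEquivalence_mapDerivedCategory` — **`D(T)` is an equivalence of categories.** With `G` a quasi-inverse of `T`
  (`T ⋙ G ≅ 𝟭`, `G ⋙ T ≅ 𝟭`, `G` additive and exact), `D(T) ⋙ D(G) ≅ 𝟭` and `D(G) ⋙ D(T) ≅ 𝟭` by uniqueness of
  localization lifts along `Q` (Mathlib `Localization.liftNatIso`: both sides lift `(T• ⋙ G•) ⋙ Q ≅ Q`, through
  `T• ⋙ G• ≅ (T ⋙ G)• ≅ 𝟭• ≅ 𝟭`, Mathlib `Functor.mapHomologicalComplexCompIso` / `mapHomologicalComplexIdIso`).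
* `map_mapDerivedCategory_bijective` — hence `D(T)` is bijective on morphisms `Hom_{D(C₁)}(X, Y)`.
* **`shiftedHom_map_mapDerivedCategory_bijective`** — the induced action on shifted Homs of complexes
  `y : Q K ⟶ (Q L)⟦n⟧ ↦ FacT.inv_K ≫ y.map D(T) ≫ FacT.hom_L⟦n⟧' : Q (T• K) ⟶ (Q (T• L))⟦n⟧` is BIJECTIVE (the
  sandwich is the one used on the Hodge road, `Summit.Ventures.HSemireg.mapShiftedHom`, which this file does not import);
  `subsingleton_shiftedHom_iff_of_isEquivalence` — in particular `Ext•_{C₂}(T• K, T• L) = 0 ↔ Ext•_{C₁}(K, L) = 0`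
  degree by degree.

In print: an exact equivalence `T` of abelian categories induces an equivalence of derived categories compatible
with `Q` and the shifts (Weibel, Cor. 10.4.7 and §10.5: a functor carrying quasi-isomorphisms to quasi-isomorphisms
descends uniquely to the localisations; applied to `T` and a quasi-inverse). Written for road №4 of the Hodge atlas
(crux stmt-HodgeConjecture-26512, route «2T» step (i): twisting by an invertible module does not change Ext-jump
loci); nothing in this file refers to it.

## References

* C. A. Weibel, *An introduction to homological algebra* (1994), §10.4 (Cor. 10.4.7), §10.5. [Weibel1994]
* Mathlib: `Algebra.Homology.DerivedCategory.ExactFunctor` (`Functor.mapDerivedCategory`, `mapDerivedCategoryFactors`),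
  `CategoryTheory.Localization.Predicate` (`Localization.liftNatIso`, `Lifting`).
-/

noncomputable section

open CategoryTheory CategoryTheory.Category CategoryTheory.Limits

namespace Literature.Algebra.Homology

universe w₁ w₂ v₁ v₂ u₁ u₂

variable {C₁ : Type u₁} [Category.{v₁} C₁] [Abelian C₁] [HasDerivedCategory.{w₁} C₁]
  {C₂ : Type u₂} [Category.{v₂} C₂] [Abelian C₂] [HasDerivedCategory.{w₂} C₂]
  (T : C₁ ⥤ C₂) [T.Additive] [PreservesFiniteLimits T] [PreservesFiniteColimits T]

/-! ### Quasi-inverse derived functors -/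

section QuasiInverse

variable (G : C₂ ⥤ C₁) [G.Additive] [PreservesFiniteLimits G] [PreservesFiniteColimits G]

/-- **`D(T) ⋙ D(G) ≅ 𝟭` from `T ⋙ G ≅ 𝟭`** for exact additive functors `T`, `G` between abelian categories: both
sides are localization lifts along `Q` of `(T• ⋙ G•) ⋙ Q ≅ 𝟭• ⋙ Q ≅ Q` (Mathlib `Localization.liftNatIso`). Stated as
`Nonempty` (a `Prop`). [cite: Weibel1994, §10.4 Cor. 10.4.7 and §10.5] -/
theorem nonempty_mapDerivedCategory_comp_iso_id (e : T ⋙ G ≅ 𝟭 C₁) :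
    Nonempty (T.mapDerivedCategory ⋙ G.mapDerivedCategory ≅ 𝟭 (DerivedCategory C₁)) := by
  -- `(T• ⋙ Q) ⋙ D(G) ≅ T• ⋙ (G• ⋙ Q) ≅ (T• ⋙ G•) ⋙ Q ≅ 𝟭• ⋙ Q ≅ Q`
  let e₁ : (T.mapHomologicalComplex (ComplexShape.up ℤ) ⋙ DerivedCategory.Q) ⋙ G.mapDerivedCategory ≅
      DerivedCategory.Q :=
    Functor.associator _ _ _ ≪≫ Functor.isoWhiskerLeft _ G.mapDerivedCategoryFactors ≪≫
      (Functor.associator _ _ _).symm ≪≫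
        Functor.isoWhiskerRight (Functor.mapHomologicalComplexCompIso e (ComplexShape.up ℤ) ≪≫
          Functor.mapHomologicalComplexIdIso C₁ (ComplexShape.up ℤ)) DerivedCategory.Q ≪≫
          Functor.leftUnitor _
  exact ⟨Localization.liftNatIso DerivedCategory.Q (HomologicalComplex.quasiIso C₁ (ComplexShape.up ℤ))
    ((T.mapHomologicalComplex (ComplexShape.up ℤ) ⋙ DerivedCategory.Q) ⋙ G.mapDerivedCategory) DerivedCategory.Q
    (T.mapDerivedCategory ⋙ G.mapDerivedCategory) (𝟭 (DerivedCategory C₁)) e₁⟩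

end QuasiInverse

/-! ### `D(T)` is an equivalence -/

variable [T.IsEquivalence]

/-- **The derived functor `D(T)` of an exact additive EQUIVALENCE `T : C₁ ≌ C₂` of abelian categories is an
equivalence `D(C₁) ≌ D(C₂)`** (quasi-inverse `D(G)` for a quasi-inverse `G` of `T`; `D(T) ⋙ D(G) ≅ 𝟭` and
`D(G) ⋙ D(T) ≅ 𝟭` by `nonempty_mapDerivedCategory_comp_iso_id`). [cite: Weibel1994, §10.4 Cor. 10.4.7 and §10.5] -/
theorem isEquivalence_mapDerivedCategory : T.mapDerivedCategory.IsEquivalence := by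
  let G : C₂ ⥤ C₁ := T.inv
  haveI : T.asEquivalence.functor.Additive := inferInstanceAs T.Additive
  haveI : G.Additive := CategoryTheory.Equivalence.inverse_additive T.asEquivalence
  obtain ⟨ε⟩ := nonempty_mapDerivedCategory_comp_iso_id T G T.asEquivalence.unitIso.symm
  obtain ⟨η⟩ := nonempty_mapDerivedCategory_comp_iso_id G T T.asEquivalence.counitIso
  exact (CategoryTheory.Equivalence.mk T.mapDerivedCategory G.mapDerivedCategory ε.symm η).isEquivalence_functor

/-- `D(T)` is bijective on morphisms of the derived category. [cite: Weibel1994, §10.4 Cor. 10.4.7 and §10.5] -/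
theorem map_mapDerivedCategory_bijective (X Y : DerivedCategory C₁) :
    Function.Bijective (T.mapDerivedCategory.map : (X ⟶ Y) → (T.mapDerivedCategory.obj X ⟶ T.mapDerivedCategory.obj Y)) := by
  haveI := isEquivalence_mapDerivedCategory T
  exact (Functor.FullyFaithful.ofFullyFaithful T.mapDerivedCategory).map_bijective X Y

/-- `y ↦ y.map D(T)` is bijective on shifted Homs `X ⟶ Y⟦n⟧` of the derived category (`y.map D(T) = D(T) y ≫
(D(T).commShiftIso n).hom_Y`). [cite: Weibel1994, §10.4 Cor. 10.4.7 and §10.5] -/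
theorem shiftedHom_map_bijective (X Y : DerivedCategory C₁) (n : ℤ) :
    Function.Bijective fun y : ShiftedHom X Y n => (y.map T.mapDerivedCategory : ShiftedHom _ _ n) := by
  have h : (fun y : ShiftedHom X Y n => (y.map T.mapDerivedCategory : ShiftedHom _ _ n)) =
      ⇑((Iso.refl (T.mapDerivedCategory.obj X)).homCongr ((T.mapDerivedCategory.commShiftIso n).app Y)) ∘
        fun y : X ⟶ Y⟦n⟧ => T.mapDerivedCategory.map y := by
    funext y
    simp only [ShiftedHom.map, Function.comp_apply, Iso.homCongr_apply, Iso.refl_inv, Category.id_comp, Iso.app_hom]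
    rfl
  rw [h]
  exact (Equiv.bijective _).comp (map_mapDerivedCategory_bijective T X (Y⟦n⟧))

/-- **The action of `D(T)` on shifted Homs OF COMPLEXES is bijective**: for cochain complexes `K`, `L` over `C₁` and
`n : ℤ`, `y : Q K ⟶ (Q L)⟦n⟧ ↦ FacT.inv_K ≫ y.map D(T) ≫ FacT.hom_L⟦n⟧' : Q (T• K) ⟶ (Q (T• L))⟦n⟧` is a bijection
`Hom_{D(C₁)}(Q K, (Q L)⟦n⟧) ≃ Hom_{D(C₂)}(Q (T• K), (Q (T• L))⟦n⟧)` (`FacT = T.mapDerivedCategoryFactors`; the sandwich is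
bijective map ∘ conjugation by isomorphisms). [cite: Weibel1994, §10.4 Cor. 10.4.7 and §10.5] -/
theorem shiftedHom_map_mapDerivedCategory_bijective (K L : CochainComplex C₁ ℤ) (n : ℤ) :
    Function.Bijective fun y : ShiftedHom (DerivedCategory.Q.obj K) (DerivedCategory.Q.obj L) n =>
      (T.mapDerivedCategoryFactors.inv.app K ≫ y.map T.mapDerivedCategory ≫
          (T.mapDerivedCategoryFactors.hom.app L)⟦n⟧' :
        ShiftedHom (DerivedCategory.Q.obj ((T.mapHomologicalComplex (ComplexShape.up ℤ)).obj K))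
          (DerivedCategory.Q.obj ((T.mapHomologicalComplex (ComplexShape.up ℤ)).obj L)) n) := by
  have h : (fun y : ShiftedHom (DerivedCategory.Q.obj K) (DerivedCategory.Q.obj L) n =>
      (T.mapDerivedCategoryFactors.inv.app K ≫ y.map T.mapDerivedCategory ≫
          (T.mapDerivedCategoryFactors.hom.app L)⟦n⟧' :
        ShiftedHom (DerivedCategory.Q.obj ((T.mapHomologicalComplex (ComplexShape.up ℤ)).obj K))
          (DerivedCategory.Q.obj ((T.mapHomologicalComplex (ComplexShape.up ℤ)).obj L)) n)) =
      ((T.mapDerivedCategoryFactors.app K).homCongr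
          ((shiftFunctor (DerivedCategory C₂) n).mapIso (T.mapDerivedCategoryFactors.app L))) ∘
        fun y : ShiftedHom (DerivedCategory.Q.obj K) (DerivedCategory.Q.obj L) n =>
          (y.map T.mapDerivedCategory : ShiftedHom _ _ n) := by
    funext y
    simp only [Function.comp_apply, Iso.homCongr_apply, Iso.app_inv, Iso.app_hom, Functor.mapIso_hom]
    rfl
  rw [h]
  exact (Equiv.bijective _).comp (shiftedHom_map_bijective T _ _ n)

/-- **`Ext` VANISHING IS INVARIANT UNDER AN EXACT EQUIVALENCE**: `Hom_{D(C₂)}(Q (T• K), (Q (T• L))⟦n⟧)` is a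
subsingleton iff `Hom_{D(C₁)}(Q K, (Q L)⟦n⟧)` is. [cite: Weibel1994, §10.4 Cor. 10.4.7 and §10.5] -/
theorem subsingleton_shiftedHom_iff_of_isEquivalence (K L : CochainComplex C₁ ℤ) (n : ℤ) :
    Subsingleton (ShiftedHom (DerivedCategory.Q.obj ((T.mapHomologicalComplex (ComplexShape.up ℤ)).obj K))
        (DerivedCategory.Q.obj ((T.mapHomologicalComplex (ComplexShape.up ℤ)).obj L)) n) ↔
      Subsingleton (ShiftedHom (DerivedCategory.Q.obj K) (DerivedCategory.Q.obj L) n) :=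
  (Equiv.ofBijective _ (shiftedHom_map_mapDerivedCategory_bijective T K L n)).symm.subsingleton_congr

end Literature.Algebra.Homology

end
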